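import Mathlib
import Literature.Probability.LatticeModels.GKSInequalities
import Summits.CriticalPhenomena.Ising3DConformalLimit.Theses.PrecisionLaplacian
import Summits.CriticalPhenomena.Ising3DConformalLimit.Theorems.PrecisionLaplacianInverseMFerromagnetEntryNonposOfPcov
import HarnessLib

/-!
# `InverseMFerromagnet` gives the amputated Lebowitz sign at the sites of the triple

Tooth `stub_amputatedLebowitz_mem_of_inverseM` of line `Sketch` (card `amputated-lebowitz-vertex-measure`)
of crux stmt-CriticalPhenomena-4801 `PrecisionLaplacian.MoebiusLimitOfTwoPointLaw` (the `z ∈ X` case of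
the equivalence VP¹ ⟺ IM between the line's lattice conjecture `stub_amputatedLebowitz` and the crux
`PrecisionLaplacian.InverseMFerromagnet`, stmt-CriticalPhenomena-4798).

Setting: the zero-field pair ferromagnet `ν_{Λ;K}` on `Λ = Fin n` (`gksExpect Finset.univ K C`,
couplings `Kᵢ ≥ 0` on two-site supports `Cᵢ`, Friedli–Velenik §3.8.1), its second-moment matrix
`Σ = (⟨σ_pσ_q⟩)_{p,q}` (positive definite: `schur_posDef` of the 4798 chain) and `Γ = Σ⁻¹`. The amputated
Lebowitz charge of a triple `X = (x₂,x₃,x₄)` at a site `z` is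
`ν_X(z) = ∑_a Γ_{z a} (W_a − ⟨σ_aσ_{x₂}σ_{x₃}σ_{x₄}⟩)`, with the Wick sum
`W_a = ⟨σ_aσ_{x₂}⟩⟨σ_{x₃}σ_{x₄}⟩ + ⟨σ_aσ_{x₃}⟩⟨σ_{x₂}σ_{x₄}⟩ + ⟨σ_aσ_{x₄}⟩⟨σ_{x₂}σ_{x₃}⟩`.

Claim (`stub_amputatedLebowitz_mem_of_inverseM`): if `Γ` has nonpositive off-diagonal entries for every
such system (the crux `InverseMFerromagnet`), then `ν_X(z) ≥ 0` whenever `x₂, x₃, x₄` are pairwise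
distinct and `z ∈ {x₂, x₃, x₄}`.

Proof (for `z = x₂`; the other two cases are the same statement with the roles of the `xᵢ` permuted, up to
commuting factors inside the integrands, `stub_amputatedLebowitz_mem_of_inverseM`). Since `Γ Σ = 1`,
`∑_a Γ_{x₂a}⟨σ_aσ_q⟩ = δ_{x₂q}`, so the second and third Wick columns contribute
`δ_{x₂x₃}⟨σ_{x₂}σ_{x₄}⟩ + δ_{x₂x₄}⟨σ_{x₂}σ_{x₃}⟩ = 0` and
`ν_X(x₂) = ∑_a Γ_{x₂a}(⟨σ_aσ_{x₂}⟩⟨σ_{x₃}σ_{x₄}⟩ − ⟨σ_aσ_{x₂}σ_{x₃}σ_{x₄}⟩)`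
(`ampLeb_charge_nonneg_head`). Termwise: at `a = x₂` the bracket is
`⟨1⟩⟨σ_{x₃}σ_{x₄}⟩ − ⟨σ_{x₃}σ_{x₄}⟩ = 0` (`σ² = 1`); at `a ≠ x₂`, `Γ_{x₂a} ≤ 0` by IM and the bracket is
`≤ 0` by GKS II (`⟨σ_A⟩⟨σ_B⟩ ≤ ⟨σ_{A∆B}⟩` with `A = {a,x₂}`, `B = {x₃,x₄}`, `σ_Aσ_B = σ_{A ∆ B}`;
`ampLeb_pair_mul_pair_le_four`), so every term is `≥ 0`.
-/

noncomputable section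

namespace Summit.CriticalPhenomena.Ising3DConformalLimit.PrecisionLaplacianMoebiusLimitOfTwoPointLaw

open Literature.Probability.LatticeModels Finset Matrix
open Summit.CriticalPhenomena.Ising3DConformalLimit.Cruxes.InverseMFerromagnet.PartialCovarianceLadder
  (schur_posDef)
open scoped symmDiff

/-- The diagonal of the second-moment matrix: `⟨σ_u σ_u⟩ = ⟨1⟩ = 1`. -/
theorem ampLeb_gksExpect_spinAt_mul_self {n m : ℕ} (K : Fin m → ℝ) (C : Fin m → Finset (Fin n))
    (u : Fin n) : gksExpect Finset.univ K C (fun ω => spinAt u ω * spinAt u ω) = 1 := by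
  simp only [spinAt_mul_self]
  unfold gksExpect
  exact div_self (gksSum_one_pos Finset.univ K C).ne'

/-- **GKS II for the bracket.** For `Kᵢ ≥ 0`, `a ≠ u` and `v ≠ w`:
`⟨σ_aσ_u⟩⟨σ_vσ_w⟩ ≤ ⟨σ_aσ_uσ_vσ_w⟩` — the second Griffiths inequality `⟨σ_A⟩⟨σ_B⟩ ≤ ⟨σ_{A ∆ B}⟩`
(`gksExpect_mul_gksExpect_le`) with `A = {a,u}`, `B = {v,w}` and `σ_Aσ_B = σ_{A ∆ B}` pointwise
(`spinProduct_mul_eq_spinProduct_symmDiff`), which covers `a ∈ {v,w}` as well (`σ_a² = 1` on both sides). -/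
theorem ampLeb_pair_mul_pair_le_four {n m : ℕ} (K : Fin m → ℝ) (C : Fin m → Finset (Fin n))
    (hK : ∀ i, 0 ≤ K i) {a u v w : Fin n} (hau : a ≠ u) (hvw : v ≠ w) :
    gksExpect Finset.univ K C (fun ω => spinAt a ω * spinAt u ω) *
        gksExpect Finset.univ K C (fun ω => spinAt v ω * spinAt w ω) ≤
      gksExpect Finset.univ K C (fun ω => spinAt a ω * spinAt u ω * spinAt v ω * spinAt w ω) := by
  have hA : spinProduct ({a, u} : Finset (Fin n)) = fun ω => spinAt a ω * spinAt u ω :=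
    funext fun ω => by rw [spinProduct, Finset.prod_pair hau]
  have hB : spinProduct ({v, w} : Finset (Fin n)) = fun ω => spinAt v ω * spinAt w ω :=
    funext fun ω => by rw [spinProduct, Finset.prod_pair hvw]
  have hAB : spinProduct (({a, u} : Finset (Fin n)) ∆ {v, w}) =
      fun ω => spinAt a ω * spinAt u ω * spinAt v ω * spinAt w ω :=
    funext fun ω => by
      rw [← spinProduct_mul_eq_spinProduct_symmDiff]
      simp only [spinProduct, Finset.prod_pair hau, Finset.prod_pair hvw]
      ring
  have h := gksExpect_mul_gksExpect_le Finset.univ K C (fun i _ => hK i) ({a, u} : Finset (Fin n)) {v, w}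
  rwa [hA, hB, hAB] at h

/-- **The charge at the head of the triple.** Assume `InverseMFerromagnet`; let `Kᵢ ≥ 0` on two-site
supports and let `u, v, w` be pairwise distinct. Then
`0 ≤ ∑_a Γ_{ua} (⟨σ_aσ_u⟩⟨σ_vσ_w⟩ + ⟨σ_aσ_v⟩⟨σ_uσ_w⟩ + ⟨σ_aσ_w⟩⟨σ_uσ_v⟩ − ⟨σ_aσ_uσ_vσ_w⟩)` for
`Γ = Σ⁻¹`, `Σ = (⟨σ_pσ_q⟩)`: `Γ Σ = 1` kills the `v`- and `w`-columns (`u ≠ v`, `u ≠ w`), leaving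
`∑_a Γ_{ua}(⟨σ_aσ_u⟩⟨σ_vσ_w⟩ − ⟨σ_aσ_uσ_vσ_w⟩)`, whose `a = u` term vanishes (`σ_u² = 1`) and whose
`a ≠ u` terms are products of two nonpositive factors (IM and GKS II). -/
theorem ampLeb_charge_nonneg_head
    (hIM : Summit.CriticalPhenomena.Ising3DConformalLimit.Theses.PrecisionLaplacian.InverseMFerromagnet)
    {n m : ℕ} (K : Fin m → ℝ) (C : Fin m → Finset (Fin n)) (hK : ∀ i, 0 ≤ K i)
    (hC : ∀ i, (C i).card = 2) {u v w : Fin n} (huv : u ≠ v) (huw : u ≠ w) (hvw : v ≠ w) :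
    0 ≤ ∑ a : Fin n,
      (Matrix.of fun (p q : Fin n) =>
          gksExpect Finset.univ K C (fun ω => spinAt p ω * spinAt q ω))⁻¹ u a *
        (gksExpect Finset.univ K C (fun ω => spinAt a ω * spinAt u ω) *
            gksExpect Finset.univ K C (fun ω => spinAt v ω * spinAt w ω) +
          gksExpect Finset.univ K C (fun ω => spinAt a ω * spinAt v ω) *
            gksExpect Finset.univ K C (fun ω => spinAt u ω * spinAt w ω) +
          gksExpect Finset.univ K C (fun ω => spinAt a ω * spinAt w ω) *
            gksExpect Finset.univ K C (fun ω => spinAt u ω * spinAt v ω) -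
          gksExpect Finset.univ K C
            (fun ω => spinAt a ω * spinAt u ω * spinAt v ω * spinAt w ω)) := by
  -- IM, GKS II and `σ_u² = 1`, before abstracting the matrix
  have hΓ : ∀ a, a ≠ u → (Matrix.of fun (p q : Fin n) =>
      gksExpect Finset.univ K C (fun ω => spinAt p ω * spinAt q ω))⁻¹ u a ≤ 0 :=
    fun a ha => hIM n m K C hK hC u a (fun h => ha h.symm)
  have hGKS : ∀ a, a ≠ u →
      gksExpect Finset.univ K C (fun ω => spinAt a ω * spinAt u ω) *
          gksExpect Finset.univ K C (fun ω => spinAt v ω * spinAt w ω) ≤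
        gksExpect Finset.univ K C (fun ω => spinAt a ω * spinAt u ω * spinAt v ω * spinAt w ω) :=
    fun a ha => ampLeb_pair_mul_pair_le_four K C hK ha hvw
  have hdiag4 : gksExpect Finset.univ K C
        (fun ω => spinAt u ω * spinAt u ω * spinAt v ω * spinAt w ω) =
      gksExpect Finset.univ K C (fun ω => spinAt v ω * spinAt w ω) := by
    simp only [spinAt_mul_self, one_mul]
  have hdiag2 : gksExpect Finset.univ K C (fun ω => spinAt u ω * spinAt u ω) = 1 :=
    ampLeb_gksExpect_spinAt_mul_self K C u
  have hpd := schur_posDef n m K C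
  -- abstract the second-moment matrix
  generalize hG : (Matrix.of fun (p q : Fin n) =>
      gksExpect Finset.univ K C (fun ω => spinAt p ω * spinAt q ω)) = G at hΓ hpd ⊢
  have hGe : ∀ p q, gksExpect Finset.univ K C (fun ω => spinAt p ω * spinAt q ω) = G p q :=
    fun p q => congrFun (congrFun hG p) q
  -- `Γ Σ = 1`: the `v`- and `w`-columns vanish
  have hΓG : G⁻¹ * G = 1 :=
    Matrix.nonsing_inv_mul G ((Matrix.isUnit_iff_isUnit_det G).mp hpd.isUnit)
  have hv0 : ∑ a, G⁻¹ u a * G a v = 0 := by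
    have h := congrFun (congrFun hΓG u) v
    rwa [Matrix.mul_apply, Matrix.one_apply_ne huv] at h
  have hw0 : ∑ a, G⁻¹ u a * G a w = 0 := by
    have h := congrFun (congrFun hΓG u) w
    rwa [Matrix.mul_apply, Matrix.one_apply_ne huw] at h
  simp only [hGe] at hGKS hdiag4 hdiag2 ⊢
  have hsplit : ∑ a, G⁻¹ u a * (G a u * G v w + G a v * G u w + G a w * G u v -
        gksExpect Finset.univ K C (fun ω => spinAt a ω * spinAt u ω * spinAt v ω * spinAt w ω)) =
      ∑ a, G⁻¹ u a * (G a u * G v w -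
          gksExpect Finset.univ K C (fun ω => spinAt a ω * spinAt u ω * spinAt v ω * spinAt w ω)) +
        (∑ a, G⁻¹ u a * G a v) * G u w + (∑ a, G⁻¹ u a * G a w) * G u v := by
    rw [Finset.sum_mul, Finset.sum_mul, ← Finset.sum_add_distrib, ← Finset.sum_add_distrib]
    exact Finset.sum_congr rfl fun a _ => by ring
  rw [hsplit, hv0, hw0, zero_mul, zero_mul, add_zero, add_zero]
  -- termwise signs
  refine Finset.sum_nonneg fun a _ => ?_
  rcases eq_or_ne a u with rfl | ha
  · rw [hdiag4, hdiag2, one_mul, sub_self, mul_zero]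
  · exact mul_nonneg_of_nonpos_of_nonpos (hΓ a ha) (sub_nonpos.2 (hGKS a ha))

/-- **Tooth `stub_amputatedLebowitz_mem_of_inverseM` (IM ⇒ VP¹ at `z ∈ {x₂,x₃,x₄}`).** Assume
`InverseMFerromagnet`. For the zero-field pair ferromagnet `gksExpect Finset.univ K C` (`Kᵢ ≥ 0`,
`|Cᵢ| = 2`) on `Fin n`, pairwise distinct `x₂, x₃, x₄` and `z ∈ {x₂, x₃, x₄}`, the amputated Lebowitz
charge `∑_a (Σ⁻¹)_{za}(W_a − ⟨σ_aσ_{x₂}σ_{x₃}σ_{x₄}⟩)` is `≥ 0`. The three cases are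
`ampLeb_charge_nonneg_head` with `(u,v,w) = (x₂,x₃,x₄)`, `(x₃,x₂,x₄)`, `(x₄,x₂,x₃)`, after commuting
factors inside the integrands (`⟨σ_pσ_q⟩ = ⟨σ_qσ_p⟩`, `σ_aσ_uσ_vσ_w = σ_aσ_{x₂}σ_{x₃}σ_{x₄}`). -/
theorem stub_amputatedLebowitz_mem_of_inverseM :
    Summit.CriticalPhenomena.Ising3DConformalLimit.Theses.PrecisionLaplacian.InverseMFerromagnet →
    ∀ (n m : ℕ) (K : Fin m → ℝ) (C : Fin m → Finset (Fin n)), (∀ i, 0 ≤ K i) → (∀ i, (C i).card = 2) →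
      ∀ z x₂ x₃ x₄ : Fin n, (x₂ ≠ x₃ ∧ x₂ ≠ x₄ ∧ x₃ ≠ x₄) → (z = x₂ ∨ z = x₃ ∨ z = x₄) →
        0 ≤ ∑ a : Fin n,
          (Matrix.of fun (p q : Fin n) =>
              gksExpect Finset.univ K C (fun ω => spinAt p ω * spinAt q ω))⁻¹ z a *
            (gksExpect Finset.univ K C (fun ω => spinAt a ω * spinAt x₂ ω) *
                gksExpect Finset.univ K C (fun ω => spinAt x₃ ω * spinAt x₄ ω) +
              gksExpect Finset.univ K C (fun ω => spinAt a ω * spinAt x₃ ω) *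
                gksExpect Finset.univ K C (fun ω => spinAt x₂ ω * spinAt x₄ ω) +
              gksExpect Finset.univ K C (fun ω => spinAt a ω * spinAt x₄ ω) *
                gksExpect Finset.univ K C (fun ω => spinAt x₂ ω * spinAt x₃ ω) -
              gksExpect Finset.univ K C
                (fun ω => spinAt a ω * spinAt x₂ ω * spinAt x₃ ω * spinAt x₄ ω)) := by
  intro hIM n m K C hK hC z x₂ x₃ x₄ hX hz
  obtain ⟨h23, h24, h34⟩ := hX
  -- symmetry of the pair expectations
  have hsym : ∀ p q : Fin n, gksExpect Finset.univ K C (fun ω => spinAt p ω * spinAt q ω) =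
      gksExpect Finset.univ K C (fun ω => spinAt q ω * spinAt p ω) :=
    fun p q => congrArg _ (funext fun ω => mul_comm _ _)
  rcases hz with hz | hz | hz <;> rw [hz]
  · exact ampLeb_charge_nonneg_head hIM K C hK hC h23 h24 h34
  · -- `(u, v, w) = (x₃, x₂, x₄)`
    refine le_of_le_of_eq (ampLeb_charge_nonneg_head hIM K C hK hC (Ne.symm h23) h34 h24)
      (Finset.sum_congr rfl fun a _ => ?_)
    have h4 : gksExpect Finset.univ K C
          (fun ω => spinAt a ω * spinAt x₃ ω * spinAt x₂ ω * spinAt x₄ ω) =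
        gksExpect Finset.univ K C
          (fun ω => spinAt a ω * spinAt x₂ ω * spinAt x₃ ω * spinAt x₄ ω) :=
      congrArg _ (funext fun ω => by ring)
    rw [h4, hsym x₃ x₂]
    ring
  · -- `(u, v, w) = (x₄, x₂, x₃)`
    refine le_of_le_of_eq
      (ampLeb_charge_nonneg_head hIM K C hK hC (Ne.symm h24) (Ne.symm h34) h23)
      (Finset.sum_congr rfl fun a _ => ?_)
    have h4 : gksExpect Finset.univ K C
          (fun ω => spinAt a ω * spinAt x₄ ω * spinAt x₂ ω * spinAt x₃ ω) =
        gksExpect Finset.univ K C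
          (fun ω => spinAt a ω * spinAt x₂ ω * spinAt x₃ ω * spinAt x₄ ω) :=
      congrArg _ (funext fun ω => by ring)
    rw [h4, hsym x₄ x₃, hsym x₄ x₂]
    ring

end Summit.CriticalPhenomena.Ising3DConformalLimit.PrecisionLaplacianMoebiusLimitOfTwoPointLaw
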